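import Literature.Claims.NS.Betts2026
import Literature.Analysis.FluidPDE.ParallelShearFlow
import Mathlib.Analysis.SpecialFunctions.Trigonometric.Deriv
import Mathlib.Analysis.SpecialFunctions.ExpDeriv
import HarnessLib

/-!
# SOLO refutation kit — C153 `Betts2026` (cell `ns-claims`, D-0090; refuter of record
# ns-claims-refuter-2 g6)

Skeleton: `Literature/Claims/NS/Betts2026.lean` (typist-6 g5, p526724, sha16 `6e9155a6c66ef82b`).

## What is refuted here, and by what
* **`not_Step_Thm63 : ¬ Step_Thm63`** — THEOREM 6.3 (88) p.15 l.43–46 (= Cor 7.8 (109) p.18)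
  «‖∇u(t)‖_{L∞} ≤ C(‖E(t)‖_{L²} + ‖∇E(t)‖_{L²}) for some constant C depending only on dimension»,
  typed for every smooth periodic solution, every flow map and EVERY `t ∈ [0,T)` — the step the
  printed proof of Prop 6.5 invokes at (90) p.16 l.11–12, right after BKM (89). At `t = 0` the flow
  map is the identity ((14) p.4 «Φ₀(a) = a»), so `F(·,0) = I`, `E(·,0) = log I = 0` (Remark 3.7 p.7;
  skeleton `entropy_zero`, `defGrad_zero`, `logStrain_one`), hence `‖E(0)‖_{L²} = ‖∇E(0)‖_{L²} = 0` and
  (88) reads `‖∇u₀‖_{L∞} ≤ 0`: false for every datum with a non-zero velocity gradient. Countermodel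
  (inside the printed class «u₀ ∈ H^s(𝕋³), s > 5/2, divergence-free», smooth sub-case): the DECAYING
  SHEAR `u(t,x) = e^{−4π²νt} sin(2πx₁) e₀`, `p = 0` — an exact `ℤ³`-periodic classical solution on
  `[0,∞) × ℝ³` (plane parallel shear flow, Acheson 1990 §2.3; tree
  `ParallelShear.isClassicalNSSolutionOn_shear`) with the explicit flow map
  `Φ_t(a) = a + sin(2πa₁)(1 − e^{−4π²νt})/(4π²ν) e₀` and `∇u₀(0) e₁ = 2π e₀ ≠ 0`.
  `thm63_fails_at` is the `ν`-explicit form (every `ν > 0`, every constant `C`).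
* Plumbing lemmas: the datum is admissible (`isDatum_shear`), the pair solves the typed class on every
  slab (`isSolutionOn_shear`), `flow` is a flow map (`isFlowMap_flow`), `‖∇E(0)‖²_{L²} = 0` for every
  flow map (`gradESq_zero`).

WHAT THIS IS NOT: not a claim about NS regularity or blow-up; not a claim about any author beyond the
typed locator.
-/

set_option linter.dupNamespace false

noncomputable section

open Set MeasureTheory Filter Function Real
open scoped ContDiff ENNReal NNReal Topology

namespace Summit.NavierStokesRegularity.NavierStokesRegularity.Theorems.Betts2026

open Literature.Analysis Literature.Analysis.FluidPDE
open Literature.Claims.NS.Betts2026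
open Literature.Claims.NS.Rockwell2025 (IsFlowMap)

/-! ## The decaying shear `u = e^{−4π²νt} sin(2πx₁) e₀` -/

/-- The heat-shear profile `φ(t, y) = e^{−4π²νt} sin(2πy)`. [cite: Acheson1990, §2.3 eqs. (2.8)–(2.9)] -/
def phi (ν : ℝ) (t y : ℝ) : ℝ := exp (-(4 * π ^ 2 * ν) * t) * sin (2 * π * y)

/-- The velocity `u(t, x) = φ(t, x₁) e₀`. [cite: Acheson1990, §2.3 eq. (2.8)] -/
def uS (ν : ℝ) : ℝ → E3 → E3 := ParallelShear.shearVelocity (phi ν)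

/-- The pressure `p ≡ 0`. [cite: Acheson1990, §2.3 eq. (2.9)] -/
def pS : ℝ → E3 → ℝ := fun _ _ => 0

/-- `φ` is jointly smooth. [folklore] -/
theorem contDiff_phi (ν : ℝ) : ContDiff ℝ ∞ (uncurry (phi ν)) := by
  have h1 : ContDiff ℝ ∞ (fun q : ℝ × ℝ => exp (-(4 * π ^ 2 * ν) * q.1)) :=
    contDiff_exp.comp (contDiff_const.mul contDiff_fst)
  have h2 : ContDiff ℝ ∞ (fun q : ℝ × ℝ => sin (2 * π * q.2)) :=
    contDiff_sin.comp (contDiff_const.mul contDiff_snd)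
  exact h1.mul h2

/-- `∂ₜφ = −4π²ν φ`. [folklore] -/
theorem hasDerivAt_phi_t (ν t y : ℝ) :
    HasDerivAt (fun τ => phi ν τ y)
      (exp (-(4 * π ^ 2 * ν) * t) * (-(4 * π ^ 2 * ν)) * sin (2 * π * y)) t := by
  have he : HasDerivAt (fun τ => exp (-(4 * π ^ 2 * ν) * τ))
      (exp (-(4 * π ^ 2 * ν) * t) * (-(4 * π ^ 2 * ν))) t := by
    have h0 := ((hasDerivAt_id' t).const_mul (-(4 * π ^ 2 * ν))).exp
    convert h0 using 1; ring
  exact he.mul_const _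

/-- `∂_yφ = 2π e^{−4π²νt} cos(2πy)`. [folklore] -/
theorem hasDerivAt_phi_y (ν t y : ℝ) :
    HasDerivAt (phi ν t) (exp (-(4 * π ^ 2 * ν) * t) * (2 * π * cos (2 * π * y))) y := by
  have hs : HasDerivAt (fun y => sin (2 * π * y)) (2 * π * cos (2 * π * y)) y := by
    have h0 := ((hasDerivAt_id' y).const_mul (2 * π)).sin
    convert h0 using 1; simp [mul_comm]
  exact hs.const_mul _

/-- `∂_yφ` as a function. [folklore] -/
theorem deriv_phi (ν t : ℝ) :
    deriv (phi ν t) = fun y => exp (-(4 * π ^ 2 * ν) * t) * (2 * π * cos (2 * π * y)) :=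
  funext fun y => (hasDerivAt_phi_y ν t y).deriv

/-- `∂²_yφ = −4π² φ`. [folklore] -/
theorem hasDerivAt_deriv_phi (ν t y : ℝ) :
    HasDerivAt (deriv (phi ν t))
      (exp (-(4 * π ^ 2 * ν) * t) * (2 * π * (-(2 * π) * sin (2 * π * y)))) y := by
  rw [deriv_phi]
  have hc : HasDerivAt (fun y => cos (2 * π * y)) (-(2 * π) * sin (2 * π * y)) y := by
    have h0 := ((hasDerivAt_id' y).const_mul (2 * π)).cos
    convert h0 using 1; simp; ring
  exact (hc.const_mul (2 * π)).const_mul _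

/-- **The decaying shear is a classical Navier–Stokes solution on `[0,∞) × ℝ³`** with zero force and
zero pressure (reduced equation `∂ₜφ = ν∂²_yφ`). [cite: Acheson1990, §2.3 eqs. (2.8)–(2.9)] -/
theorem uS_isClassical (ν : ℝ) : IsClassicalNSSolutionOn (Ici 0) ν 0 (uS ν) pS := by
  have h : IsClassicalNSSolutionOn (Ici 0) ν (ParallelShear.shearForce fun _ _ => 0) (ParallelShear.shearVelocity (phi ν))
      (ParallelShear.shearPressure fun _ => 0) := by
    refine ParallelShear.isClassicalNSSolutionOn_shear (uniqueDiffOn_Ici 0) (contDiff_phi ν).contDiffOn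
      contDiffOn_const fun t ht y => ?_
    rw [(hasDerivAt_phi_t ν t y).hasDerivWithinAt.derivWithin (uniqueDiffOn_Ici 0 t ht),
      (hasDerivAt_deriv_phi ν t y).deriv]
    ring
  have hf : (ParallelShear.shearForce fun _ _ => (0 : ℝ)) = 0 := by funext t x; simp [ParallelShear.shearForce]
  have hp : (ParallelShear.shearPressure fun _ => (0 : ℝ)) = pS := by funext t x; simp [ParallelShear.shearPressure, pS]
  rw [hf, hp] at h
  exact h

/-- `u(t, ·)` is `ℤ³`-periodic. [folklore] -/
theorem uS_periodic (ν t : ℝ) : IsLatticePeriodic (uS ν t) := by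
  intro i x
  change ParallelShear.shearVelocity (phi ν) t (x + EuclideanSpace.single i 1) = ParallelShear.shearVelocity (phi ν) t x
  simp only [ParallelShear.shearVelocity, phi, PiLp.add_apply]
  by_cases h : i = 1
  · subst h
    rw [show (EuclideanSpace.single (1 : Fin 3) (1 : ℝ) : E3) 1 = 1 by simp,
      show 2 * π * (x 1 + 1) = 2 * π * x 1 + 2 * π by ring, sin_add_two_pi]
  · rw [show (EuclideanSpace.single i (1 : ℝ) : E3) 1 = 0 by simp [Ne.symm h], add_zero]

/-- The datum `u₀ = sin(2πx₁) e₀` is admissible: smooth, divergence-free, periodic. [folklore] -/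
theorem isDatum_shear (ν : ℝ) : IsDatum (uS ν 0) where
  smooth := by
    have hφ : ContDiff ℝ ∞ (phi ν 0) := by
      have hmap : ContDiff ℝ ∞ (fun y : ℝ => (((0 : ℝ), y) : ℝ × ℝ)) :=
        contDiff_const.prodMk contDiff_id
      exact (contDiff_phi ν).comp hmap
    have h1 : ContDiff ℝ ∞ (fun x : E3 => phi ν 0 (x 1)) :=
      hφ.comp (EuclideanSpace.proj (1 : Fin 3) : E3 →L[ℝ] ℝ).contDiff
    exact h1.smul contDiff_const
  divFree := by
    intro x
    have hd : DifferentiableAt ℝ (phi ν 0) (x 1) := (hasDerivAt_phi_y ν 0 (x 1)).differentiableAt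
    exact ParallelShear.divergence_profile hd
  periodic := uS_periodic ν 0

/-- **The pair `(u, 0)` is a solution of the typed class on every slab `[0,T)`.** [folklore] -/
theorem isSolutionOn_shear (ν T : ℝ) : IsSolutionOn (Ico 0 T) ν (uS ν 0) (uS ν) pS where
  solves := (uS_isClassical ν).mono Ico_subset_Ici_self (uniqueDiffOn_Ico 0 T)
  initial := rfl
  periodic t _ := ⟨uS_periodic ν t, fun _ _ => rfl⟩

/-! ## The explicit flow map -/

/-- `G(t) = (1 − e^{−4π²νt})/(4π²ν) = ∫₀ᵗ e^{−4π²νs} ds`. [folklore] -/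
def G (ν : ℝ) (t : ℝ) : ℝ := (1 - exp (-(4 * π ^ 2 * ν) * t)) / (4 * π ^ 2 * ν)

/-- The flow map `Φ_t(a) = a + G(t) sin(2πa₁) e₀` of the shear. [folklore] -/
def flow (ν : ℝ) (t : ℝ) (a : E3) : E3 :=
  a + (G ν t * sin (2 * π * a 1)) • EuclideanSpace.single (0 : Fin 3) (1 : ℝ)

/-- `G(0) = 0`. [folklore] -/
theorem G_zero (ν : ℝ) : G ν 0 = 0 := by simp [G]

/-- `G'(t) = e^{−4π²νt}` for `ν ≠ 0`. [folklore] -/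
theorem hasDerivAt_G {ν : ℝ} (hν : ν ≠ 0) (t : ℝ) :
    HasDerivAt (G ν) (exp (-(4 * π ^ 2 * ν) * t)) t := by
  have hc : (4 * π ^ 2 * ν) ≠ 0 := by positivity
  have he : HasDerivAt (fun τ => exp (-(4 * π ^ 2 * ν) * τ))
      (exp (-(4 * π ^ 2 * ν) * t) * (-(4 * π ^ 2 * ν))) t := by
    have h0 := ((hasDerivAt_id' t).const_mul (-(4 * π ^ 2 * ν))).exp
    convert h0 using 1; ring
  have h := (he.const_sub 1).div_const (4 * π ^ 2 * ν)
  refine h.congr_deriv ?_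
  field_simp

/-- The stream coordinate is conserved: `(Φ_t a)₁ = a₁`. [folklore] -/
theorem flow_apply_one (ν t : ℝ) (a : E3) : flow ν t a 1 = a 1 := by
  simp [flow]

/-- **`Φ` is a flow map of the shear on every slab** (`Φ₀ = id`, `∂ₜΦ_t(a) = u(t, Φ_t(a))`). [folklore] -/
theorem isFlowMap_flow {ν : ℝ} (hν : 0 < ν) (T : ℝ) : IsFlowMap T (uS ν) (flow ν) := by
  refine ⟨fun a => by simp [flow, G_zero], fun a t _ => ?_⟩
  have hd : HasDerivAt (fun s => flow ν s a)
      ((exp (-(4 * π ^ 2 * ν) * t) * sin (2 * π * a 1)) •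
        EuclideanSpace.single (0 : Fin 3) (1 : ℝ)) t :=
    (((hasDerivAt_G hν.ne' t).mul_const (sin (2 * π * a 1))).smul_const
      (EuclideanSpace.single (0 : Fin 3) (1 : ℝ))).const_add a
  have hu : uS ν t (flow ν t a) =
      (exp (-(4 * π ^ 2 * ν) * t) * sin (2 * π * a 1)) • EuclideanSpace.single (0 : Fin 3) (1 : ℝ) := by
    change ParallelShear.shearVelocity (phi ν) t (flow ν t a) = _
    rw [ParallelShear.shearVelocity, flow_apply_one, phi]
  rw [hu]
  exact hd.hasDerivWithinAt

/-! ## At `t = 0`: `‖∇E(0)‖_{L²} = 0` for every flow map, `∇u₀(0) ≠ 0` -/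

/-- For every flow map, `‖∇E(·,0)‖²_{L²} = 0` (`F(·,0) = I`, `E(·,0) = 0` is constant in the label).
[cite: Betts2026, (14) p.4; Remark 3.7 p.7 l.48–52] -/
theorem gradESq_zero {T : ℝ} {u : ℝ → E3 → E3} {Φ : ℝ → E3 → E3} (hΦ : IsFlowMap T u Φ) :
    gradESq Φ 0 = 0 := by
  have hE : (fun b => logStrain (defGrad Φ 0 b)) = fun _ => (0 : Op) := by
    funext b
    rw [defGrad_zero hΦ, logStrain_one]
  unfold gradESq Literature.Claims.NS.Betts2026.torusIntegral
  rw [hE]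
  simp [fderiv_const_apply, ContinuousLinearMap.opNorm_zero]

/-- The velocity gradient of the datum at the origin is non-zero: `∇u₀(0) e₁ = 2π e₀`. [folklore] -/
theorem fderiv_uS_zero_ne (ν : ℝ) : fderiv ℝ (uS ν 0) 0 ≠ 0 := by
  have hd : Differentiable ℝ (phi ν 0) := fun y => (hasDerivAt_phi_y ν 0 y).differentiableAt
  have h := ParallelShear.fderiv_profile hd (0 : E3)
  change fderiv ℝ (uS ν 0) 0 = _ at h
  rw [h, deriv_phi]
  intro h0
  have h1 := congrArg (fun L : E3 →L[ℝ] E3 => L (EuclideanSpace.single 1 1) 0) h0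
  simp [pi_ne_zero] at h1

/-- `‖∇u₀‖_{L∞} > 0` (as the supremum of the extended norms). [folklore] -/
theorem iSup_enorm_fderiv_uS_pos (ν : ℝ) : 0 < ⨆ x : E3, ‖fderiv ℝ (uS ν 0) x‖ₑ := by
  have h0 : 0 < ‖fderiv ℝ (uS ν 0) 0‖ₑ := by
    rw [← ofReal_norm, ENNReal.ofReal_pos, norm_pos_iff]
    exact fderiv_uS_zero_ne ν
  exact lt_of_lt_of_le h0 (le_iSup (fun x : E3 => ‖fderiv ℝ (uS ν 0) x‖ₑ) 0)

/-! ## The refutation -/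

/-- **Thm 6.3 (88) fails at `t = 0` along the decaying shear, for every `ν > 0` and every constant `C`.**
[cite: Betts2026, Thm 6.3 (88) p.15 l.43–46; (90) p.16 l.11–12; (14) p.4; Remark 3.7 p.7] -/
theorem thm63_fails_at {ν : ℝ} (hν : 0 < ν) (C : ℝ≥0) :
    ¬ ((⨆ x : E3, ‖fderiv ℝ (uS ν 0) x‖ₑ) ≤
        C * (ENNReal.ofReal (normE (flow ν) 0) + ENNReal.ofReal (Real.sqrt (gradESq (flow ν) 0)))) := by
  have hΦ := isFlowMap_flow hν 1
  rw [normE, entropy_zero hΦ, gradESq_zero hΦ, Real.sqrt_zero, ENNReal.ofReal_zero, add_zero,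
    mul_zero, not_le]
  exact iSup_enorm_fderiv_uS_pos ν

/-- **Refutes `Step_Thm63`** (Thm 6.3 (88) p.15 l.43–46 = Cor 7.8 p.18, invoked at (90) p.16): at
`t = 0` the right side vanishes for every flow (`E(·,0) = 0`), the left side is `‖∇u₀‖_{L∞} > 0` for the
decaying shear `e^{−4π²νt} sin(2πx₁) e₀` (here `ν = 1`, `T = 1`). [cite: Betts2026, Thm 6.3 (88) p.15 l.43–46; (90) p.16 l.11–12] -/
theorem not_Step_Thm63 : ¬ Step_Thm63 := by
  rintro ⟨C, hC⟩
  have h := hC 1 one_pos (uS 1 0) (isDatum_shear 1) 1 (uS 1) pS (flow 1) one_pos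
    (isSolutionOn_shear 1 1) (isFlowMap_flow one_pos 1) 0 ⟨le_rfl, one_pos⟩
  exact thm63_fails_at one_pos C h

end Summit.NavierStokesRegularity.NavierStokesRegularity.Theorems.Betts2026
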